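import Summits.ValiantsHypothesis.ValiantsHypothesis.Theorems.SymPencilPerFourPeeledTwoPencilDesign

/-!
# Route `SymPencil` — inner rank of the `2 | 2` row split of `per_4`, PEELED case: the first
# FRAME FILE — the universal Σ₀ frame (and class V, two null `a`-rows) on `≤ 11` squares
# (`--supports` stmt-ValiantsHypothesis-5674 `SdcSuperquadratic`; (8,8) column of the size tables,
# memo `NOTE-p8g15-5674-R2-two-pencil.md` §4/§7; rung currency only)

**Theorem** (`false_of_sigma0_universal`; corollary `false_of_two_null_rows`).  A reduced peeled
family on `|κ| ≤ 11` squares cannot have `a₀` with non-zero coordinates and `a₁ ∉ K a₀` with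
`ψ(a_j, a₀∘z_i) = 0` for the universal pair `z₀ = (1,2,-1,-2)`, `z₁ = (3,-1,-1,-1)`; in particular
no two linearly independent `a₀, a₁` with `t((a_j,0),(y,0)) = 0` for all `y` (`a_j ∈ ker Ψᵀ`; the
class «`rank Ψ ≤ 2` and no coordinate vector in the column space of `Ψ`»).

Proof = an explicit Σ₀ two-pencil frame fed to `…PeeledTwoPencilDesign.false_of_frame`:
`y_i := a₀ ∘ z_i` with the universal `z₀ = (1,2,-1,-2)`, `z₁ = (3,-1,-1,-1)` (`Σ z_i = 0`); then
`P(a₀, a₀∘z) = (Π a₀) D⁻¹ 𝐇(z) D⁻¹` with `𝐇(z) = ½ U D_z U`, `U = J - 2I`, `U² = 4`, so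
`W₀ = (8 Π a₀)⁻¹ D U D_{z₀}⁻¹ U D`, the pencil has the eigenbasis `a₀ ∘ (𝟙 - 2e_i)` with eigenvalues
`z₁ᵢ/z₀ᵢ = (3, -½, 1, ½)`, and `Q = P₁₁ - P₁₀ W₀ P₀₁ ≠ 0` because `Q` is linear in `a₁`, vanishes only
on `K a₀` (three explicit entries), and `a₁ ∉ K a₀`.

Honest framing: ONE class of the frame-existence case analysis; no cell closes here; the window
`27 ≤ sdc(per_4) ≤ 29`, the crux `SdcSuperquadratic` and `VP ≠ VNP` are untouched.  No definitions,
no named facts. [folklore]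
-/

noncomputable section

-- single-conjunct layout: Sub = Summit, duplicated namespace component intended
set_option linter.dupNamespace false

namespace Summit.ValiantsHypothesis.ValiantsHypothesis.Theorems.SymPencilPerFourPeeledTwoPencilSigmaZero

open Matrix Finset Module
open Summit.ValiantsHypothesis.ValiantsHypothesis.Theorems.SymPencilPerFourInnerRankRows
open Summit.ValiantsHypothesis.ValiantsHypothesis.Theorems.SymPencilPerFourPeeledTwoPencilDesign

universe u v

variable {K : Type u} [Field K]

/-- Entries of the pure permanent matrix `P(a, a∘z)`: off the diagonal
`per(a; e_b; a∘z; e_l) · a_b a_l = (Π a)(σ(z) - z_b - z_l)`, and `0` on the diagonal. [folklore] -/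
theorem per_single_had (a z : Fin 4 → K) (b l : Fin 4) :
    (Matrix.of ![a, Pi.single b (1 : K), (fun k => a k * z k), Pi.single l 1]).permanent * (a b * a l) =
      if b = l then 0 else (a 0 * a 1 * a 2 * a 3) * ((z 0 + z 1 + z 2 + z 3) - z b - z l) := by
  fin_cases b <;> fin_cases l <;> simp [permanent_of_rows] <;> ring

/-- Division form of `per_single_had` (all `a_k ≠ 0`). [folklore] -/
theorem per_single_had_div (a z : Fin 4 → K) (ha : ∀ k, a k ≠ 0) (b l : Fin 4) :
    (Matrix.of ![a, Pi.single b (1 : K), (fun k => a k * z k), Pi.single l 1]).permanent =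
      (if b = l then 0 else (a 0 * a 1 * a 2 * a 3) * ((z 0 + z 1 + z 2 + z 3) - z b - z l)) /
        (a b * a l) := by
  rw [eq_div_iff (mul_ne_zero (ha b) (ha l))]
  exact per_single_had a z b l

/-- Entries of the mixed permanent matrix `P(x, a∘z)`. [folklore] -/
theorem per_single_mixed (x a z : Fin 4 → K) (b l : Fin 4) :
    (Matrix.of ![x, Pi.single b (1 : K), (fun k => a k * z k), Pi.single l 1]).permanent =
      if b = l then 0 else
        ∑ p, ∑ q, if p ≠ b ∧ p ≠ l ∧ q ≠ b ∧ q ≠ l ∧ p < q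
          then x p * (a q * z q) + x q * (a p * z p) else 0 := by
  fin_cases b <;> fin_cases l <;> simp [permanent_of_rows, Fin.sum_univ_four]

/-! ### Numeric facts for the universal Σ₀ pair `z₀ = (1,2,-1,-2)`, `z₁ = (3,-1,-1,-1)` -/

/-- `U = J - 2I` squares to `4`. [folklore] -/
theorem numU_sq : (Matrix.of ![![-1, 1, 1, 1], ![1, -1, 1, 1], ![1, 1, -1, 1], ![1, 1, 1, -1]] : Matrix (Fin 4) (Fin 4) K) * (Matrix.of ![![-1, 1, 1, 1], ![1, -1, 1, 1], ![1, 1, -1, 1], ![1, 1, 1, -1]] : Matrix (Fin 4) (Fin 4) K) = (4 : K) • (1 : Matrix (Fin 4) (Fin 4) K) := by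
  ext i j; fin_cases i <;> fin_cases j <;> simp [Matrix.mul_apply, Fin.sum_univ_four] <;> norm_num

/-- `(U D_{z₀}⁻¹ U) · 𝐇(z₀) = 8`. [folklore] -/
theorem numW_H0 : (Matrix.of ![![0, -3, 0, -1], ![-3, 0, 1, 0], ![0, 1, 0, 3], ![-1, 0, 3, 0]] : Matrix (Fin 4) (Fin 4) K) * (Matrix.of ![![0, -3, 0, 1], ![-3, 0, -1, 0], ![0, -1, 0, 3], ![1, 0, 3, 0]] : Matrix (Fin 4) (Fin 4) K) = (8 : K) • (1 : Matrix (Fin 4) (Fin 4) K) := by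
  ext i j; fin_cases i <;> fin_cases j <;> simp [Matrix.mul_apply, Fin.sum_univ_four] <;> norm_num

/-- `𝐇(z₁) · (U D_{z₀}⁻¹ U)`. [folklore] -/
theorem numH1_W : (Matrix.of ![![0, -2, -2, -2], ![-2, 0, 2, 2], ![-2, 2, 0, 2], ![-2, 2, 2, 0]] : Matrix (Fin 4) (Fin 4) K) * (Matrix.of ![![0, -3, 0, -1], ![-3, 0, 1, 0], ![0, 1, 0, 3], ![-1, 0, 3, 0]] : Matrix (Fin 4) (Fin 4) K) = (Matrix.of ![![8, -2, -8, -6], ![-2, 8, 6, 8], ![-8, 6, 8, 2], ![-6, 8, 2, 8]] : Matrix (Fin 4) (Fin 4) K) := by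
  ext i j; fin_cases i <;> fin_cases j <;> simp [Matrix.mul_apply, Fin.sum_univ_four] <;> norm_num

/-- The rows of `U` are eigenvectors of `𝐇(z₀)` with eigenvalues `2 z₀`. [folklore] -/
theorem numH0_eig (j : Fin 4) : (Matrix.of ![![0, -3, 0, 1], ![-3, 0, -1, 0], ![0, -1, 0, 3], ![1, 0, 3, 0]] : Matrix (Fin 4) (Fin 4) K) *ᵥ ((Matrix.of ![![-1, 1, 1, 1], ![1, -1, 1, 1], ![1, 1, -1, 1], ![1, 1, 1, -1]] : Matrix (Fin 4) (Fin 4) K) j) = ((2 : K) * (![1, 2, -1, -2] : Fin 4 → K) j) • (Matrix.of ![![-1, 1, 1, 1], ![1, -1, 1, 1], ![1, 1, -1, 1], ![1, 1, 1, -1]] : Matrix (Fin 4) (Fin 4) K) j := by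
  fin_cases j <;>
    (funext k; fin_cases k <;> simp [Matrix.mulVec, dotProduct, Fin.sum_univ_four] <;> norm_num)

/-- The rows of `U` are eigenvectors of `𝐇(z₁)` with eigenvalues `2 z₁`. [folklore] -/
theorem numH1_eig (j : Fin 4) : (Matrix.of ![![0, -2, -2, -2], ![-2, 0, 2, 2], ![-2, 2, 0, 2], ![-2, 2, 2, 0]] : Matrix (Fin 4) (Fin 4) K) *ᵥ ((Matrix.of ![![-1, 1, 1, 1], ![1, -1, 1, 1], ![1, 1, -1, 1], ![1, 1, 1, -1]] : Matrix (Fin 4) (Fin 4) K) j) = ((2 : K) * (![3, -1, -1, -1] : Fin 4 → K) j) • (Matrix.of ![![-1, 1, 1, 1], ![1, -1, 1, 1], ![1, 1, -1, 1], ![1, 1, 1, -1]] : Matrix (Fin 4) (Fin 4) K) j := by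
  fin_cases j <;>
    (funext k; fin_cases k <;> simp [Matrix.mulVec, dotProduct, Fin.sum_univ_four] <;> norm_num)

/-- **The universal Σ₀ frame.**  A reduced peeled family on `|κ| ≤ 11` squares admits no pair
`a₀` (non-zero coordinates), `a₁ ∉ K a₀` with `ψ(a_j, a₀ ∘ z_i) = 0` for the universal
`z₀ = (1,2,-1,-2)`, `z₁ = (3,-1,-1,-1)` (as `t((a_j,0),(a₀∘z_i,0)) = 0`).  See the module docstring.
[folklore] -/
theorem false_of_sigma0_universal [CharZero K] {κ : Type v} [Fintype κ] [DecidableEq κ]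
    (hκ : Fintype.card κ ≤ 11) (c : κ → K)
    (t : κ → (((Fin 4 → K) × (Fin 4 → K)) →ₗ[K] ((Fin 4 → K) × (Fin 4 → K)) →ₗ[K] K))
    (hJ : ∀ a b y₂ y₃ : Fin 4 → K,
      ∑ r, c r * (t r (a, b) (y₂, y₃)) ^ 2 = (Matrix.of ![a, b, y₂, y₃]).permanent)
    (v₀ v₀' : κ → K) (hv₀ : ∀ (a x : Fin 4 → K), ∃ s : K, (fun r => t r (a, 0) (x, 0)) = s • v₀)
    (hv₀' : ∀ (b x : Fin 4 → K), ∃ s : K, (fun r => t r (0, b) (0, x)) = s • v₀')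
    (hpeel : ∃ a b y z : Fin 4 → K, ∑ r, c r * t r (a, 0) (y, 0) * t r (0, b) (0, z) ≠ 0)
    (a₀ a₁ : Fin 4 → K) (ha : ∀ k, a₀ k ≠ 0) (hind : ∀ μ : K, a₁ ≠ μ • a₀)
    (hψ₀₀ : ∀ r, t r (a₀, 0) ((fun k => a₀ k * (![1, 2, -1, -2] : Fin 4 → K) k), 0) = 0)
    (hψ₀₁ : ∀ r, t r (a₀, 0) ((fun k => a₀ k * (![3, -1, -1, -1] : Fin 4 → K) k), 0) = 0)
    (hψ₁₀ : ∀ r, t r (a₁, 0) ((fun k => a₀ k * (![1, 2, -1, -2] : Fin 4 → K) k), 0) = 0)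
    (hψ₁₁ : ∀ r, t r (a₁, 0) ((fun k => a₀ k * (![3, -1, -1, -1] : Fin 4 → K) k), 0) = 0) :
    False := by
  -- the universal Σ₀ pair
  let z₀ : Fin 4 → K := ![1, 2, -1, -2]
  let z₁ : Fin 4 → K := ![3, -1, -1, -1]
  have hz₀ : z₀ 0 = 1 ∧ z₀ 1 = 2 ∧ z₀ 2 = -1 ∧ z₀ 3 = -2 := ⟨rfl, rfl, rfl, rfl⟩
  have hz₁ : z₁ 0 = 3 ∧ z₁ 1 = -1 ∧ z₁ 2 = -1 ∧ z₁ 3 = -1 := ⟨rfl, rfl, rfl, rfl⟩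
  let y₀ : Fin 4 → K := fun k => a₀ k * z₀ k
  let y₁ : Fin 4 → K := fun k => a₀ k * z₁ k
  -- the four pure permanent matrices
  let P₀₀ : Matrix (Fin 4) (Fin 4) K :=
    Matrix.of fun b l => (Matrix.of ![a₀, Pi.single b 1, y₀, Pi.single l 1]).permanent
  let P₁₀ : Matrix (Fin 4) (Fin 4) K :=
    Matrix.of fun b l => (Matrix.of ![a₀, Pi.single b 1, y₁, Pi.single l 1]).permanent
  let P₀₁ : Matrix (Fin 4) (Fin 4) K :=
    Matrix.of fun b l => (Matrix.of ![a₁, Pi.single b 1, y₀, Pi.single l 1]).permanent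
  let P₁₁ : Matrix (Fin 4) (Fin 4) K :=
    Matrix.of fun b l => (Matrix.of ![a₁, Pi.single b 1, y₁, Pi.single l 1]).permanent
  -- scalars and diagonal matrices
  set pa : K := a₀ 0 * a₀ 1 * a₀ 2 * a₀ 3 with hpa
  have hpa0 : pa ≠ 0 := by
    rw [hpa]; exact mul_ne_zero (mul_ne_zero (mul_ne_zero (ha 0) (ha 1)) (ha 2)) (ha 3)
  let D : Matrix (Fin 4) (Fin 4) K := Matrix.diagonal a₀
  let Di : Matrix (Fin 4) (Fin 4) K := Matrix.diagonal fun k => (a₀ k)⁻¹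
  have hDDi : D * Di = 1 := by
    rw [Matrix.diagonal_mul_diagonal, ← Matrix.diagonal_one]
    congr 1; funext k; exact mul_inv_cancel₀ (ha k)
  have hDiD : Di * D = 1 := by
    rw [Matrix.diagonal_mul_diagonal, ← Matrix.diagonal_one]
    congr 1; funext k; exact inv_mul_cancel₀ (ha k)
  -- numeric matrices: U = J - 2I, the Hessians 𝐇(z₀), 𝐇(z₁), and U D_{z₀}⁻¹ U
  let U : Matrix (Fin 4) (Fin 4) K := Matrix.of ![![-1, 1, 1, 1], ![1, -1, 1, 1], ![1, 1, -1, 1], ![1, 1, 1, -1]]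
  let H0 : Matrix (Fin 4) (Fin 4) K := Matrix.of ![![0, -3, 0, 1], ![-3, 0, -1, 0], ![0, -1, 0, 3], ![1, 0, 3, 0]]
  let H1 : Matrix (Fin 4) (Fin 4) K := Matrix.of ![![0, -2, -2, -2], ![-2, 0, 2, 2], ![-2, 2, 0, 2], ![-2, 2, 2, 0]]
  let Wn : Matrix (Fin 4) (Fin 4) K := Matrix.of ![![0, -3, 0, -1], ![-3, 0, 1, 0], ![0, 1, 0, 3], ![-1, 0, 3, 0]]
  have hUU : U * U = (4 : K) • (1 : Matrix (Fin 4) (Fin 4) K) := numU_sq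
  have hWH : Wn * H0 = (8 : K) • (1 : Matrix (Fin 4) (Fin 4) K) := numW_H0
  -- the transport identities P(a₀, a₀∘z) = pa • Di 𝐇(z) Di
  have T0 : P₀₀ = pa • (Di * H0 * Di) := by
    ext b l
    simp only [P₀₀, y₀, Matrix.of_apply]
    rw [per_single_had_div a₀ z₀ ha b l, Matrix.smul_apply, smul_eq_mul,
      Matrix.mul_diagonal, Matrix.diagonal_mul, ← hpa]
    have hb := ha b; have hl := ha l
    fin_cases b <;> fin_cases l <;> simp [H0, z₀] <;> field_simp <;> ring
  have T1 : P₁₀ = pa • (Di * H1 * Di) := by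
    ext b l
    simp only [P₁₀, y₁, Matrix.of_apply]
    rw [per_single_had_div a₀ z₁ ha b l, Matrix.smul_apply, smul_eq_mul,
      Matrix.mul_diagonal, Matrix.diagonal_mul, ← hpa]
    have hb := ha b; have hl := ha l
    fin_cases b <;> fin_cases l <;> simp [H1, z₁] <;> field_simp <;> ring
  -- W₀ and the inverse relation
  let W₀ : Matrix (Fin 4) (Fin 4) K := (8 * pa)⁻¹ • (D * Wn * D)
  have hc1 : ∀ X : Matrix (Fin 4) (Fin 4) K, D * (Di * X) = X := fun X => by
    rw [← Matrix.mul_assoc, hDDi, Matrix.one_mul]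
  have hc2 : ∀ X : Matrix (Fin 4) (Fin 4) K, Di * (D * X) = X := fun X => by
    rw [← Matrix.mul_assoc, hDiD, Matrix.one_mul]
  have hW₀ : W₀ * P₀₀ = 1 := by
    show ((8 * pa)⁻¹ • (D * Wn * D)) * P₀₀ = 1
    rw [T0, Matrix.smul_mul, Matrix.mul_smul, smul_smul]
    simp only [Matrix.mul_assoc]
    rw [hc1, ← Matrix.mul_assoc Wn H0, hWH, Matrix.smul_mul, Matrix.one_mul, Matrix.mul_smul, hDDi,
      smul_smul]
    have : (8 * pa)⁻¹ * pa * 8 = (1 : K) := by field_simp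
    rw [this, one_smul]
  -- N = H1 * Wn and the product P₁₀ W₀
  let N : Matrix (Fin 4) (Fin 4) K :=
    Matrix.of ![![8, -2, -8, -6], ![-2, 8, 6, 8], ![-8, 6, 8, 2], ![-6, 8, 2, 8]]
  have hN : H1 * Wn = N := numH1_W
  have hPW : P₁₀ * W₀ = (8 : K)⁻¹ • (Di * N * D) := by
    show P₁₀ * ((8 * pa)⁻¹ • (D * Wn * D)) = _
    rw [T1, Matrix.smul_mul, Matrix.mul_smul, smul_smul]
    simp only [Matrix.mul_assoc]
    rw [hc2, ← Matrix.mul_assoc H1 Wn, hN]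
    have : pa * (8 * pa)⁻¹ = (8 : K)⁻¹ := by field_simp
    rw [this]
  -- eigen-data: v_j = a₀ ∘ U_j, s = z₁/z₀ = (3, -1/2, 1, 1/2), W = ¼ Di U
  let v : Fin 4 → Fin 4 → K := fun j k => a₀ k * U j k
  let s : Fin 4 → K := ![3, -1/2, 1, 1/2]
  have hvD : ∀ j, v j = D *ᵥ U j := fun j => by
    funext k; simp [v, D, Matrix.mulVec_diagonal]
  have hHU0 : ∀ j, H0 *ᵥ U j = (2 * z₀ j) • U j := fun j => numH0_eig j
  have hHU1 : ∀ j, H1 *ᵥ U j = (2 * z₁ j) • U j := fun j => numH1_eig j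
  have hsz : ∀ j, s j * z₀ j = z₁ j := by
    intro j; fin_cases j <;> simp [s, z₀, z₁]
  have hDD : ∀ H : Matrix (Fin 4) (Fin 4) K, Di * H * Di * D = Di * H := fun H => by
    rw [Matrix.mul_assoc, hDiD, Matrix.mul_one]
  have hv : ∀ j, P₁₀ *ᵥ v j = s j • P₀₀ *ᵥ v j := by
    intro j
    rw [T0, T1, hvD, Matrix.smul_mulVec, Matrix.smul_mulVec, Matrix.mulVec_mulVec,
      Matrix.mulVec_mulVec, hDD, hDD, ← Matrix.mulVec_mulVec, ← Matrix.mulVec_mulVec, hHU0, hHU1,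
      Matrix.mulVec_smul, Matrix.mulVec_smul, smul_smul, smul_smul, smul_smul, ← hsz j]
    congr 1
    ring
  have hs : ∀ i j, i ≠ j → s i ≠ s j := by
    intro i j hij
    fin_cases i <;> fin_cases j <;> simp [s] at hij ⊢ <;> norm_num
  let W : Matrix (Fin 4) (Fin 4) K := (4 : K)⁻¹ • (Di * U)
  have hW : W * Matrix.of v = 1 := by
    have hofv : Matrix.of v = U * D := by
      ext i k; simp [v, D, Matrix.mul_diagonal, mul_comm]
    show ((4 : K)⁻¹ • (Di * U)) * Matrix.of v = 1
    rw [hofv, Matrix.smul_mul, Matrix.mul_assoc, ← Matrix.mul_assoc U U, hUU, Matrix.smul_mul,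
      Matrix.one_mul, Matrix.mul_smul, hDiD, smul_smul]
    have : (4 : K)⁻¹ * 4 = 1 := by field_simp
    rw [this, one_smul]
  -- Q ≠ 0 : three entries of Q, linear in a₁, vanish together only for a₁ ∥ a₀
  have hQ : P₁₁ - P₁₀ * W₀ * P₀₁ ≠ 0 := by
    intro hQ0
    have h0 := ha 0; have h1 := ha 1; have h2 := ha 2; have h3 := ha 3
    have e30 : (P₁₁ - P₁₀ * W₀ * P₀₁) 3 0 =
        (1/2) * a₀ 2 * a₁ 1 - a₀ 1 * a₁ 2 + (1/2) * a₀ 1 * a₀ 2 * a₁ 3 / a₀ 3 := by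
      rw [Matrix.sub_apply, hPW, Matrix.mul_apply]
      simp [Fin.sum_univ_four, Matrix.smul_apply, Di, D, N, Matrix.mul_diagonal, Matrix.diagonal_mul,
        P₁₁, P₀₁, y₀, y₁, z₀, z₁, per_single_mixed]
      field_simp
      ring
    have e10 : (P₁₁ - P₁₀ * W₀ * P₀₁) 1 0 =
        (5/2) * a₀ 2 * a₀ 3 * a₁ 1 / a₀ 1 - a₀ 3 * a₁ 2 - (3/2) * a₀ 2 * a₁ 3 := by
      rw [Matrix.sub_apply, hPW, Matrix.mul_apply]
      simp [Fin.sum_univ_four, Matrix.smul_apply, Di, D, N, Matrix.mul_diagonal, Matrix.diagonal_mul,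
        P₁₁, P₀₁, y₀, y₁, z₀, z₁, per_single_mixed]
      field_simp
      ring
    have e01 : (P₁₁ - P₁₀ * W₀ * P₀₁) 0 1 =
        -(11/4) * a₀ 2 * a₀ 3 * a₁ 0 / a₀ 0 + (7/4) * a₀ 3 * a₁ 2 + a₀ 2 * a₁ 3 := by
      rw [Matrix.sub_apply, hPW, Matrix.mul_apply]
      simp [Fin.sum_univ_four, Matrix.smul_apply, Di, D, N, Matrix.mul_diagonal, Matrix.diagonal_mul,
        P₁₁, P₀₁, y₀, y₁, z₀, z₁, per_single_mixed]
      field_simp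
      ring
    rw [hQ0, Matrix.zero_apply] at e30 e10 e01
    -- clear denominators
    have E1 : a₀ 2 * a₀ 3 * a₁ 1 - 2 * a₀ 1 * a₀ 3 * a₁ 2 + a₀ 1 * a₀ 2 * a₁ 3 = 0 := by
      have := e30.symm
      field_simp at this
      linear_combination this
    have E2 : 5 * a₀ 2 * a₀ 3 * a₁ 1 - 2 * a₀ 1 * a₀ 3 * a₁ 2 - 3 * a₀ 1 * a₀ 2 * a₁ 3 = 0 := by
      have := e10.symm
      field_simp at this
      linear_combination this
    have E3 : -(11 * a₀ 2 * a₀ 3 * a₁ 0) + 7 * a₀ 0 * a₀ 3 * a₁ 2 + 4 * a₀ 0 * a₀ 2 * a₁ 3 = 0 := by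
      have := e01.symm
      field_simp at this
      linear_combination this
    -- the ratios agree
    have R13 : a₀ 3 * a₁ 1 = a₀ 1 * a₁ 3 := by
      have h : a₀ 2 * (4 * (a₀ 3 * a₁ 1 - a₀ 1 * a₁ 3)) = 0 := by linear_combination E2 - E1
      have h' := (mul_eq_zero.1 h).resolve_left h2
      have h'' := (mul_eq_zero.1 h').resolve_left (by norm_num)
      linear_combination h''
    have R23 : a₀ 2 * a₁ 3 = a₀ 3 * a₁ 2 := by
      have h : a₀ 1 * (2 * (a₀ 2 * a₁ 3 - a₀ 3 * a₁ 2)) = 0 := by linear_combination E1 - a₀ 2 * R13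
      have h' := (mul_eq_zero.1 h).resolve_left h1
      have h'' := (mul_eq_zero.1 h').resolve_left (by norm_num)
      linear_combination h''
    have R02 : a₀ 0 * a₁ 2 = a₀ 2 * a₁ 0 := by
      have h : a₀ 3 * (11 * (a₀ 0 * a₁ 2 - a₀ 2 * a₁ 0)) = 0 := by
        linear_combination E3 - 4 * a₀ 0 * R23
      have h' := (mul_eq_zero.1 h).resolve_left h3
      have h'' := (mul_eq_zero.1 h').resolve_left (by norm_num)
      linear_combination h''
    -- hence a₁ = (a₁ 0 / a₀ 0) • a₀
    have hprop : ∀ k, a₁ k * a₀ 0 = a₁ 0 * a₀ k := by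
      intro k
      fin_cases k
      · simp only [Fin.zero_eta]
      · simp only [Fin.mk_one]
        have key : a₀ 2 * a₀ 3 * (a₁ 1 * a₀ 0 - a₁ 0 * a₀ 1) = 0 := by
          linear_combination (a₀ 0 * a₀ 2) * R13 + (a₀ 0 * a₀ 1) * R23 + (a₀ 1 * a₀ 3) * R02
        have := (mul_eq_zero.1 key).resolve_left (mul_ne_zero h2 h3)
        linear_combination this
      · simp only [Fin.reduceFinMk]
        linear_combination R02
      · simp only [Fin.reduceFinMk]
        have key : a₀ 2 * (a₁ 3 * a₀ 0 - a₁ 0 * a₀ 3) = 0 := by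
          linear_combination (a₀ 0) * R23 + (a₀ 3) * R02
        have := (mul_eq_zero.1 key).resolve_left h2
        linear_combination this
    apply hind (a₁ 0 / a₀ 0)
    funext k
    rw [Pi.smul_apply, smul_eq_mul, div_mul_eq_mul_div, eq_div_iff h0]
    exact hprop k
  exact false_of_frame hκ c t hJ v₀ v₀' hv₀ hv₀' hpeel a₀ a₁ y₀ y₁
    hψ₀₀ hψ₀₁ hψ₁₀ hψ₁₁ P₀₀ P₁₀ P₀₁ P₁₁
    (fun b l => rfl) (fun b l => rfl) (fun b l => rfl) (fun b l => rfl) W₀ hW₀ v s hv hs W hW hQ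

/-- **Two null `a`-rows are contradictory** (class V of the memo: `a₀, a₁ ∈ ker Ψᵀ`, i.e. the
row-blocks `t((a_j,0),(·,0))` vanish identically; e.g. `rank Ψ ≤ 2` with no coordinate vector in
the column space of `Ψ`). [folklore] -/
theorem false_of_two_null_rows [CharZero K] {κ : Type v} [Fintype κ] [DecidableEq κ]
    (hκ : Fintype.card κ ≤ 11) (c : κ → K)
    (t : κ → (((Fin 4 → K) × (Fin 4 → K)) →ₗ[K] ((Fin 4 → K) × (Fin 4 → K)) →ₗ[K] K))
    (hJ : ∀ a b y₂ y₃ : Fin 4 → K,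
      ∑ r, c r * (t r (a, b) (y₂, y₃)) ^ 2 = (Matrix.of ![a, b, y₂, y₃]).permanent)
    (v₀ v₀' : κ → K) (hv₀ : ∀ (a x : Fin 4 → K), ∃ s : K, (fun r => t r (a, 0) (x, 0)) = s • v₀)
    (hv₀' : ∀ (b x : Fin 4 → K), ∃ s : K, (fun r => t r (0, b) (0, x)) = s • v₀')
    (hpeel : ∃ a b y z : Fin 4 → K, ∑ r, c r * t r (a, 0) (y, 0) * t r (0, b) (0, z) ≠ 0)
    (a₀ a₁ : Fin 4 → K) (ha : ∀ k, a₀ k ≠ 0) (hind : ∀ μ : K, a₁ ≠ μ • a₀)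
    (hnull₀ : ∀ (y : Fin 4 → K) r, t r (a₀, 0) (y, 0) = 0)
    (hnull₁ : ∀ (y : Fin 4 → K) r, t r (a₁, 0) (y, 0) = 0) : False :=
  false_of_sigma0_universal hκ c t hJ v₀ v₀' hv₀ hv₀' hpeel a₀ a₁ ha hind
    (hnull₀ _) (hnull₀ _) (hnull₁ _) (hnull₁ _)

end Summit.ValiantsHypothesis.ValiantsHypothesis.Theorems.SymPencilPerFourPeeledTwoPencilSigmaZero

end
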